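import Summits.MatrixMultiplication.OmegaCensus.ThreeSetLineNormFilterLemmas
import HarnessLib

/-!
# The certificate-free NORM FILTER for the three-set line identity, III: soundness of the block checkers

ω-census `pub-omega`, family (b3), seat pub-omega-group gen 41.  Framing: lottery ticket; floor = certified bounds/negative
ranges.  VALUE: a kernel TOOL for the three-set cube cells `(4, d, e)@p²`; NOT progress on ω.
* **`normBlock_sound`** — the reference checker (semantic shape of `hkill`, `ThreeSetZpCells4Core`; any `K`, any bound `e`):
  a datum passes when `T(D_X) = n` divides no `T(Γ_s) = m_s` (`norm_dvd_of_line_identity3` + `normS_eq_mul_self` +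
  `Int.pow_dvd_pow_iff`), or when its `(ℓ, r)` certificates check (`LineUnit.datumChk_sound`);
* `permF_eq`, `towerF_eq`, `isConst_of_isConstF`, **`normBlockF_sound`**; `towerX_eq`, `all_not_dvd_of_prod`,
  **`normBlockX_sound`**; **`normBlockL_sound`** — the fast variants reduce to the reference checker.
-/

namespace Summit.MatrixMultiplication.OmegaCensus

open Finset Polynomial LineInv

namespace LineNorm

/-! ## Soundness of the block checker -/

section Sound

variable {p : ℕ} [hp : Fact p.Prime]

/-- **Soundness of the norm filter** (semantic shape of `hkill`, `ThreeSetZpCells4Core`; any `K`, any bound `e`).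
[folklore] -/
theorem normBlock_sound {K e X g gi d : ℕ} {dlog : List ℕ} {st : List Bool} {W : List ℕ} {Fs : List (List ℕ)}
    {ms : List ℤ} {exc : List (List ℕ × List (ℕ × ℕ × ℕ × ℕ))} (h : normBlock p X g gi dlog st d W Fs ms exc = true) :
    ∀ F ∈ Fs, ∀ (G : ZMod p → ℕ) (s : ZMod p), (∀ u, G u ≤ e) →
      ¬ ∀ τ : ZMod p, (∑ u : ZMod p, lineMat3 (vecFn W) (vecFn F) τ u * G u) + (if s = τ then 1 else 0) = K := by
  intro F hF G s _ hid
  unfold normBlock at h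
  dsimp only at h
  simp only [Bool.and_eq_true, decide_eq_true_eq, beq_iff_eq] at h
  obtain ⟨⟨⟨⟨⟨⟨⟨⟨⟨⟨⟨hX2, hWlen⟩, hdX⟩, hWX⟩, hggi⟩, hdl⟩, h2h⟩, hB1⟩, hB2⟩, hmslen⟩, hgam⟩, hall⟩ := h
  rw [List.all_eq_true] at hall hgam
  have hFd := hall F hF
  rw [Bool.or_eq_true] at hFd
  rcases hFd with hN | hC
  swap
  · exact LineUnit.datumChk_sound hC G s K hid
  -- the norm branch
  unfold normDatum at hN
  simp only [Bool.and_eq_true, beq_iff_eq] at hN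
  obtain ⟨⟨hFlen, hFsum⟩, hN⟩ := hN
  set hh := (tower p X gi st 1).2 with hhh
  have hg' := not_dvd_of_mul_mod_eq_one (p := p) hggi
  -- D side
  have hFX : F.sum < X := by rw [hFsum]; exact hdX
  have hB1' : 3 * (F.sum * W.sum) ^ 2 < X := by
    rw [hFsum]
    exact lt_of_le_of_lt (le_trans (le_of_eq (pow_one _).symm)
      (pow_le_pow_exp _ le_rfl (hhh ▸ tower_k_pos (p := p) (X := X) gi st 1))) hB1
  obtain ⟨d1, d2, d3⟩ := Phi_dNum (p := p) hX2 hWlen hFlen hWX hFX hB1'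
  cases htv : tval p X gi st (dNum p X (ofList X W) (perm p X (p - 1) (ofList X W)) F) with
  | none => rw [htv] at hN; exact Bool.false_ne_true hN
  | some n =>
    rw [htv] at hN
    rw [List.all_eq_true] at hN
    have hkD : (tower p X gi st (dNum p X (ofList X W) (perm p X (p - 1) (ofList X W)) F)).2 = hh := by
      rw [hhh]; exact tower_k_eq gi st _ _
    have hTn := tval_sound (p := p) hX2 hggi d3 (by rw [d2, hkD, hFsum]; exact hB1) htv
    rw [hkD, d1] at hTn
    have hNn := normS_eq_mul_self p hg' hdl h2h hTn
    -- Γ side for the hole `s`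
    have hsv : s.val < p := ZMod.val_lt s
    have hgs := hgam s.val (List.mem_range.2 hsv)
    rw [beq_iff_eq] at hgs
    obtain ⟨g1, g2, g3⟩ := Phi_gNum (p := p) hX2 hWlen hWX (lt_of_le_of_lt (le_trans (le_of_eq (pow_one _).symm)
      (pow_le_pow_exp _ le_rfl (hhh ▸ tower_k_pos (p := p) (X := X) gi st 1))) hB2) hsv
    have hkG : (tower p X gi st (gNum p X (ofList X W) (perm p X (p - 1) (ofList X W)) s.val)).2 = hh := by
      rw [hhh]; exact tower_k_eq gi st _ _
    have hTm := tval_sound (p := p) hX2 hggi g3 (by rw [g2, hkG]; exact hB2) hgs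
    rw [hkG, g1] at hTm
    obtain ⟨e1, e2⟩ := gamma_exponents (p := p) s
    rw [e1, e2] at hTm
    have hNm := normS_eq_mul_self p hg' hdl h2h
      (z := levc (rho p) (vecFn W : ZMod p → ℕ) ^ 2 * zch (rho p) s ^ 2 -
        lev (rho p) (vecFn W : ZMod p → ℕ) * levc (rho p) (vecFn W : ZMod p → ℕ) +
        lev (rho p) (vecFn W : ZMod p → ℕ) ^ 2 * zch (rho p) (-s) ^ 2) (n := ms.getD s.val 0)
      (by rw [← hTm]; congr 1; ring)
    -- the divisibility
    have hdvd := norm_dvd_of_line_identity3 (vecFn W) (vecFn F) G s K hid (n := n * n)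
      (g := ms.getD s.val 0 * ms.getD s.val 0) (by rw [hNn]; push_cast; ring) (by rw [hNm]; push_cast; ring)
    rw [← pow_two, ← pow_two, Int.pow_dvd_pow_iff two_ne_zero] at hdvd
    have hmem : ms.getD s.val 0 ∈ ms := by
      rw [List.getD_eq_getElem _ _ (by rw [hmslen]; exact hsv)]
      exact List.getElem_mem _
    have hne := hN _ hmem
    rw [bne_iff_ne, ne_eq] at hne
    exact hne (Int.emod_eq_zero_of_dvd hdvd)

end Sound




/-! ## The fast variants agree with the reference functions -/

section Fast

variable {p : ℕ} [hp : Fact p.Prime]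

omit hp in
/-- `permF` through the shift table of `gi` is `perm`. [folklore] -/
theorem permF_eq (B gi a : ℕ) : permF B (shifts p B gi) a = perm p (2 ^ B) gi a := by
  unfold permF perm shifts
  generalize List.range p = L
  induction L with
  | nil => rfl
  | cons u L ih =>
    rw [List.map_cons, List.map_cons, List.foldr_cons, enc, ih, Nat.shiftRight_eq_div_pow, pow_mul]

omit hp in
/-- `shiftsFor` tracks the same exponent as `tower`. [folklore] -/
theorem shiftsFor_snd (B gi : ℕ) : ∀ (st : List Bool) (z : ℕ), (shiftsFor p B gi st).2 = (tower p (2 ^ B) gi st z).2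
  | [], _ => rfl
  | true :: st, z => by simp only [shiftsFor, tower]; rw [shiftsFor_snd B gi st z]
  | false :: st, z => by simp only [shiftsFor, tower]; rw [shiftsFor_snd B gi st z]

omit hp in
/-- `towerF` with the tables of `shiftsFor` is `tower`. [folklore] -/
theorem towerF_eq (B gi : ℕ) : ∀ (st : List Bool) (z : ℕ),
    towerF p B (shiftsFor p B gi st).1 st z = (tower p (2 ^ B) gi st z).1
  | [], z => rfl
  | true :: st, z => by
    simp only [shiftsFor, towerF, tower]
    rw [towerF_eq B gi st z, permF_eq, shiftsFor_snd B gi st z]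
  | false :: st, z => by
    simp only [shiftsFor, towerF, tower]
    rw [towerF_eq B gi st z, permF_eq, shiftsFor_snd B gi st z]

omit hp in
/-- The one-comparison constancy test implies the digit-wise one. [folklore] -/
theorem isConst_of_isConstF {X a : ℕ} (hX : 2 ≤ X) (h : isConstF p X a = true) : isConst p X a = true := by
  unfold isConstF at h
  rw [beq_iff_eq] at h
  unfold isConst
  rw [List.all_eq_true]
  intro v hv
  rw [Bool.or_eq_true, decide_eq_true_eq, beq_iff_eq]
  rcases Nat.eq_zero_or_pos v with h0 | hpos
  · exact Or.inl h0
  · right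
    have hv' := List.mem_range.1 hv
    -- digit `v` of `a` is digit `v − 1` of `a / X = c · Σ_{u<p−1} X^u`, i.e. `c`
    set c := a / X % X with hc'
    have hc : c < X := Nat.mod_lt _ (by omega)
    have e1 : a / X ^ v % X = digit X (a / X) (v - 1) := by
      rw [digit, Nat.div_div_eq_div_mul, ← pow_succ', Nat.sub_add_cancel hpos]
    have e2 : c * enc X (List.replicate (p - 1) 1) = enc X (List.replicate (p - 1) c) := by
      rw [← enc_map_mul]
      congr 1
      simp [List.map_replicate]
    rw [e1, h, e2, digit_enc (by omega) _ _ (fun x hx => by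
      rw [List.mem_replicate] at hx; rw [hx.2]; exact hc)]
    rw [List.getD_eq_getElem?_getD, List.getElem?_replicate, if_pos (by omega), Option.getD_some]

omit hp in
/-- `tvalF = tval` whenever `tvalF` succeeds. [folklore] -/
theorem tval_of_tvalF {B gi : ℕ} (hX : 2 ≤ 2 ^ B) {st : List Bool} {z : ℕ} {n : ℤ}
    (h : tvalF p B (shiftsFor p B gi st).1 st z = some n) : tval p (2 ^ B) gi st z = some n := by
  unfold tvalF at h
  unfold tval
  rw [towerF_eq] at h
  dsimp only at h
  split_ifs at h with hc
  rw [if_pos (isConst_of_isConstF hX hc)]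
  exact h

omit hp in
/-- `normDatumF = true` gives `normDatum = true`. [folklore] -/
theorem normDatum_of_normDatumF {B gi d : ℕ} (hX : 2 ≤ 2 ^ B) {st : List Bool} {W : List ℕ} {ms : List ℤ} {F : List ℕ}
    (h : normDatumF p B d (shiftsFor p B gi st).1 st (shifts p B (p - 1)) (ofList (2 ^ B) W)
      (permF B (shifts p B (p - 1)) (ofList (2 ^ B) W)) ms F = true) :
    normDatum p (2 ^ B) gi d st (ofList (2 ^ B) W) (perm p (2 ^ B) (p - 1) (ofList (2 ^ B) W)) ms F = true := by
  unfold normDatumF at h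
  unfold normDatum dNum
  rw [permF_eq] at h
  dsimp only at h ⊢
  rw [permF_eq] at h
  simp only [Bool.and_eq_true] at h ⊢
  refine ⟨h.1, ?_⟩
  have h2 := h.2
  cases htv : tvalF p B (shiftsFor p B gi st).1 st (cmul p (2 ^ B) (cmul p (2 ^ B) (ofList (2 ^ B) F)
      (perm p (2 ^ B) (p - 1) (ofList (2 ^ B) W))) (cmul p (2 ^ B) (ofList (2 ^ B) F) (perm p (2 ^ B) (p - 1)
      (ofList (2 ^ B) W))) + cmul p (2 ^ B) (cmul p (2 ^ B) (ofList (2 ^ B) F) (perm p (2 ^ B) (p - 1) (ofList (2 ^ B) W)))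
      (cmul p (2 ^ B) (perm p (2 ^ B) (p - 1) (ofList (2 ^ B) F)) (ofList (2 ^ B) W)) + cmul p (2 ^ B)
      (cmul p (2 ^ B) (perm p (2 ^ B) (p - 1) (ofList (2 ^ B) F)) (ofList (2 ^ B) W)) (cmul p (2 ^ B)
      (perm p (2 ^ B) (p - 1) (ofList (2 ^ B) F)) (ofList (2 ^ B) W))) with
  | none => rw [htv] at h2; exact absurd h2 Bool.false_ne_true
  | some n => rw [htv] at h2; rw [tval_of_tvalF hX htv]; exact h2

/-- **Soundness of the fast block checker.** [folklore] -/
theorem normBlockF_sound {K e B g gi d : ℕ} {dlog : List ℕ} {st : List Bool} {W : List ℕ} {Fs : List (List ℕ)}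
    {ms : List ℤ} {exc : List (List ℕ × List (ℕ × ℕ × ℕ × ℕ))} (h : normBlockF p B g gi dlog st d W Fs ms exc = true) :
    ∀ F ∈ Fs, ∀ (G : ZMod p → ℕ) (s : ZMod p), (∀ u, G u ≤ e) →
      ¬ ∀ τ : ZMod p, (∑ u : ZMod p, lineMat3 (vecFn W) (vecFn F) τ u * G u) + (if s = τ then 1 else 0) = K := by
  refine normBlock_sound (X := 2 ^ B) (g := g) (gi := gi) (dlog := dlog) (st := st) (d := d) (ms := ms) (exc := exc) ?_
  unfold normBlockF at h
  unfold normBlock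
  dsimp only at h ⊢
  simp only [Bool.and_eq_true, decide_eq_true_eq, beq_iff_eq] at h ⊢
  obtain ⟨⟨⟨⟨⟨⟨⟨⟨⟨⟨⟨hX2, hWlen⟩, hdX⟩, hWX⟩, hggi⟩, hdl⟩, h2h⟩, hB1⟩, hB2⟩, hmslen⟩, hgam⟩, hall⟩ := h
  have hh : (shiftsFor p B gi st).2 = (tower p (2 ^ B) gi st 1).2 := shiftsFor_snd B gi st 1
  rw [hh] at h2h hB1 hB2
  refine ⟨⟨⟨⟨⟨⟨⟨⟨⟨⟨⟨hX2, hWlen⟩, hdX⟩, hWX⟩, hggi⟩, hdl⟩, h2h⟩, hB1⟩, hB2⟩, hmslen⟩, ?_⟩, ?_⟩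
  · rw [List.all_eq_true] at hgam ⊢
    intro sv hsv
    have hs := hgam sv hsv
    rw [beq_iff_eq] at hs ⊢
    rw [permF_eq] at hs
    exact tval_of_tvalF hX2 hs
  · rw [List.all_eq_true] at hall ⊢
    intro F hF
    have hF' := hall F hF
    rw [Bool.or_eq_true] at hF' ⊢
    rcases hF' with h1 | h2
    · exact Or.inl (normDatum_of_normDatumF hX2 h1)
    · exact Or.inr h2

end Fast

/-! ## The literal-parameter variants agree with the fast ones -/

section Lit

variable {p : ℕ} [hp : Fact p.Prime]

omit hp in
/-- [folklore] -/
theorem cmulM_eq {X a b : ℕ} : cmulM (X ^ p) a b = cmul p X a b := rfl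

omit hp in
/-- [folklore] -/
theorem permX_eq {B : ℕ} (es : List ℕ) (a : ℕ) : permX (2 ^ B) es a = permF B es a := rfl

omit hp in
/-- [folklore] -/
theorem towerX_eq {B : ℕ} : ∀ (ess : List (List ℕ)) (st : List Bool) (z : ℕ),
    towerX (2 ^ B) ((2 ^ B) ^ p) ess st z = towerF p B ess st z
  | es :: ess, true :: st, z => by simp only [towerX, towerF]; rw [towerX_eq ess st z]; rfl
  | es :: ess, false :: st, z => by simp only [towerX, towerF]; rw [towerX_eq ess st z]; rfl
  | [], [], z => rfl
  | [], _ :: _, z => rfl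
  | _ :: _, [], z => rfl

omit hp in
/-- [folklore] -/
theorem tvalX_eq {B : ℕ} (ess : List (List ℕ)) (st : List Bool) (z : ℕ) :
    tvalX p (2 ^ B) ((2 ^ B) ^ p) ess st z = tvalF p B ess st z := by
  unfold tvalX tvalF; rw [towerX_eq]

/-- `n ∤ P = ∏ ms` implies `n ∤ m` for every `m ∈ ms`. [folklore] -/
theorem all_not_dvd_of_prod {n P : ℤ} {ms : List ℤ} (hP : P = ms.prod) (h : (P % n != 0) = true) :
    (ms.all fun m => m % n != 0) = true := by
  rw [List.all_eq_true]
  intro m hm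
  rw [bne_iff_ne, ne_eq] at h ⊢
  intro hmn
  apply h
  rw [hP]
  exact Int.emod_eq_zero_of_dvd (dvd_trans (Int.dvd_of_emod_eq_zero hmn) (List.dvd_prod hm))

omit hp in
/-- `normDatumX = true` gives `normDatumF = true`. [folklore] -/
theorem normDatumF_of_normDatumX {B d : ℕ} {ess : List (List ℕ)} {st : List Bool} {esr : List ℕ} {w wc : ℕ}
    {ms : List ℤ} {F : List ℕ}
    (h : normDatumX p (2 ^ B) ((2 ^ B) ^ p) d ess st esr w wc ms.prod F = true) :
    normDatumF p B d ess st esr w wc ms F = true := by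
  unfold normDatumX at h
  unfold normDatumF
  simp only [cmulM_eq, permX_eq, tvalX_eq] at h
  dsimp only at h ⊢
  simp only [Bool.and_eq_true] at h ⊢
  refine ⟨h.1, ?_⟩
  have h2 := h.2
  split at h2
  · exact absurd h2 Bool.false_ne_true
  · exact all_not_dvd_of_prod rfl h2

/-- **Soundness of the literal-parameter block checker.** [folklore] -/
theorem normBlockX_sound {K e B X M g gi d : ℕ} {dlog : List ℕ} {st : List Bool} {W : List ℕ} {Fs : List (List ℕ)}
    {ms : List ℤ} {exc : List (List ℕ × List (ℕ × ℕ × ℕ × ℕ))}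
    (h : normBlockX p B X M g gi dlog st d W Fs ms exc = true) :
    ∀ F ∈ Fs, ∀ (G : ZMod p → ℕ) (s : ZMod p), (∀ u, G u ≤ e) →
      ¬ ∀ τ : ZMod p, (∑ u : ZMod p, lineMat3 (vecFn W) (vecFn F) τ u * G u) + (if s = τ then 1 else 0) = K := by
  refine normBlockF_sound (B := B) (g := g) (gi := gi) (dlog := dlog) (st := st) (d := d) (ms := ms) (exc := exc) ?_
  unfold normBlockX at h
  unfold normBlockF
  dsimp only at h ⊢
  simp only [Bool.and_eq_true, decide_eq_true_eq, beq_iff_eq] at h ⊢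
  obtain ⟨⟨⟨⟨⟨⟨⟨⟨⟨⟨⟨⟨⟨hXB, hM⟩, hX2⟩, hWlen⟩, hdX⟩, hWX⟩, hggi⟩, hdl⟩, h2h⟩, hB1⟩, hB2⟩, hmslen⟩, hgam⟩, hall⟩ := h
  subst hXB
  subst hM
  refine ⟨⟨⟨⟨⟨⟨⟨⟨⟨⟨⟨hX2, hWlen⟩, hdX⟩, hWX⟩, hggi⟩, hdl⟩, h2h⟩, hB1⟩, hB2⟩, hmslen⟩, ?_⟩, ?_⟩
  · rw [List.all_eq_true] at hgam ⊢
    intro sv hsv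
    have hs := hgam sv hsv
    rw [beq_iff_eq] at hs ⊢
    rw [tvalX_eq, permX_eq] at hs
    exact hs
  · rw [List.all_eq_true] at hall ⊢
    intro F hF
    have hF' := hall F hF
    rw [Bool.or_eq_true] at hF' ⊢
    rcases hF' with h1 | h2
    · left
      rw [permX_eq] at h1
      exact normDatumF_of_normDatumX h1
    · exact Or.inr h2

end Lit

section LitL

variable {p : ℕ} [hp : Fact p.Prime]

/-- **Soundness of the all-literal block checker.** [folklore] -/
theorem normBlockL_sound {K e B X M g gi d : ℕ} {dlog : List ℕ} {st : List Bool} {W : List ℕ} {wL wcL : ℕ} {esrL : List ℕ}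
    {essL : List (List ℕ)} {PL : ℤ} {Fs : List (List ℕ)} {ms : List ℤ} {exc : List (List ℕ × List (ℕ × ℕ × ℕ × ℕ))}
    (h : normBlockL p B X M g gi dlog st d W wL wcL esrL essL PL Fs ms exc = true) :
    ∀ F ∈ Fs, ∀ (G : ZMod p → ℕ) (s : ZMod p), (∀ u, G u ≤ e) →
      ¬ ∀ τ : ZMod p, (∑ u : ZMod p, lineMat3 (vecFn W) (vecFn F) τ u * G u) + (if s = τ then 1 else 0) = K := by
  refine normBlockX_sound (B := B) (X := X) (M := M) (g := g) (gi := gi) (dlog := dlog) (st := st) (d := d) (ms := ms)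
    (exc := exc) ?_
  unfold normBlockL at h
  unfold normBlockX
  dsimp only at h ⊢
  simp only [Bool.and_eq_true, beq_iff_eq] at h ⊢
  obtain ⟨⟨⟨⟨⟨⟨⟨⟨⟨⟨⟨⟨⟨⟨⟨⟨⟨⟨hw, hesr⟩, hwc⟩, hess⟩, hP⟩, hXB⟩, hM⟩, hX2⟩, hWlen⟩, hdX⟩, hWX⟩, hggi⟩, hdl⟩, h2h⟩, hB1⟩,
    hB2⟩, hmslen⟩, hgam⟩, hall⟩ := h
  subst hesr; subst hw; subst hwc; subst hess; subst hP
  exact ⟨⟨⟨⟨⟨⟨⟨⟨⟨⟨⟨⟨⟨hXB, hM⟩, hX2⟩, hWlen⟩, hdX⟩, hWX⟩, hggi⟩, hdl⟩, h2h⟩, hB1⟩, hB2⟩, hmslen⟩, hgam⟩, hall⟩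

end LitL

end LineNorm

end Summit.MatrixMultiplication.OmegaCensus
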